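import Summits.MatrixMultiplication.MatrixMultiplication.Theorems.ObstructionDescentUniversalOccurrenceTwoRectangleOddHookTableaux

set_option linter.dupNamespace false
set_option autoImplicit false

/-!
# Universal occurrence — two rectangles and the type `(2N-7,5,1,1)`, part A′: the value of `e_T` (decomp-mm · lens 3 · gen 44)

Route `route-MatrixMultiplication-ObstructionDescent` (sub-problem `MatrixMultiplication`, `ω(ℂ) = 2`); SUPPORT for the crux
`NoOccurrenceObstruction` (`P_O`, item `stmt-MatrixMultiplication-29040`) through the universal-occurrence programme; the
combinatorial input of the THIRD FOUR-ODD FAMILY `((2^N),(2^N),(2N-7,5,1,1)) ∈ S(⟨m⟩)`, `m ≥ N + 2`, `N ≥ 6` (part E,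
`…TwoRectangleOddFive`).  No `def`, no `sorry`.

The tableau `T` of shape `(2N-7,5,1,1)` (column `p ↦ (p,0)`, `p < 4`; dominoes `2k+4 ↦ (0,k+1)`, `2k+5 ↦ (1,k+1)`, `k < 4`;
arm `p ↦ (0,p-7)`, `p ≥ 12`; part A).  Here: the VALUE of the polytabloid `e_T` on its support.  §1: on a NORMALISED word
(arm `0`, each domino read `0` over `1`, column read by `π ∈ S_4`) `e_T = sgn π` (`u = w_T ∘ π̃`, `π̃ ∈ C_T`); flipping one
domino changes the sign (`(2k+4 2k+5) ∈ C_T`).  §2: hence `e_T(u) = sgn π · (-1)^{u(4)+u(6)+u(8)+u(10)}` (induction on the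
number of flipped dominoes), packaged as a parity (`oddFiveTableau_apply_eq_parity`) — the form consumed by part D.

[cite: BurgisserIkenmeyer2011, Thm. 4.4] [cite: BurgisserIkenmeyerPanovaJAMS2019, §3(b) (3.5)] (polytabloids: folklore,
e.g. Fulton, Young Tableaux, §7.2 Lemma 2)
-/

noncomputable section

open scoped BigOperators

namespace Summit.MatrixMultiplication.MatrixMultiplication.Theorems.ObstructionCalculus

open Literature.Computability.AlgebraicComplexity
open Literature.NumberTheory.DiophantineGeometry

/-! ### §1 Normalised words and domino flips -/

/-- **`e_T` on a normalised word.**  If `u` vanishes on the arm, reads `0` over `1` down every domino and `π ∈ S_4` down the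
column, then `e_T(u) = sgn π` (`u = w_T ∘ π̃` with `π̃ ∈ C_T` the extension of `π`). [folklore] -/
theorem oddFiveTableau_apply_of_normal {N : ℕ} {Y : YoungDiagram} (hN : ∀ x ∈ Y.cells, x.1 < N) (T : StdFilling (N * 2) Y)
    (hT : ∀ p : Fin (N * 2), T.1 p =
      (if (p : ℕ) < 4 then ((p : ℕ), 0) else if (p : ℕ) < 12 then ((p : ℕ) % 2, (p : ℕ) / 2 - 1) else (0, (p : ℕ) - 7)))
    (h12 : 12 ≤ N * 2) {u : Word N (N * 2)} (harm : ∀ p : Fin (N * 2), 12 ≤ (p : ℕ) → ((u p : Fin N) : ℕ) = 0)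
    (hdom : ∀ p : Fin (N * 2), 4 ≤ (p : ℕ) → (p : ℕ) < 12 → ((u p : Fin N) : ℕ) = (p : ℕ) % 2)
    (π : Equiv.Perm (Fin 4)) (hπ : ∀ (p : Fin (N * 2)) (hp : (p : ℕ) < 4), ((π ⟨p, hp⟩ : Fin 4) : ℕ) = ((u p : Fin N) : ℕ)) :
    T.polytabloid ℂ hN u = ((Equiv.Perm.sign π : ℤ) : ℂ) := by
  classical
  let f : Fin 4 ≃ {p : Fin (N * 2) // (p : ℕ) < 4} :=
    { toFun := fun i => ⟨⟨i, by omega⟩, i.2⟩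
      invFun := fun p => ⟨p.1, p.2⟩
      left_inv := fun i => Fin.ext rfl
      right_inv := fun p => Subtype.ext (Fin.ext rfl) }
  obtain ⟨E, hE⟩ : ∃ E : Equiv.Perm (Fin (N * 2)), E = π.extendDomain f := ⟨_, rfl⟩
  have hE_lt : ∀ (p : Fin (N * 2)) (hp : (p : ℕ) < 4), ((E p : Fin (N * 2)) : ℕ) = ((π ⟨p, hp⟩ : Fin 4) : ℕ) := by
    intro p hp
    rw [hE, Equiv.Perm.extendDomain_apply_subtype π f hp]
    rfl
  have hE_ge : ∀ p : Fin (N * 2), ¬ (p : ℕ) < 4 → E p = p := fun p hp => by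
    rw [hE]; exact Equiv.Perm.extendDomain_apply_not_subtype π f hp
  have hrow' : ∀ q : Fin (N * 2), (T.1 q).1 =
      if (q : ℕ) < 4 then (q : ℕ) else if (q : ℕ) < 12 then (q : ℕ) % 2 else 0 := fun q => by
    rw [hT]; split_ifs <;> rfl
  have hcol' : ∀ q : Fin (N * 2), (T.1 q).2 =
      if (q : ℕ) < 4 then 0 else if (q : ℕ) < 12 then (q : ℕ) / 2 - 1 else (q : ℕ) - 7 := fun q => by
    rw [hT]; split_ifs <;> rfl
  have hEcol : E ∈ T.colStab := StdFilling.mem_colStab.2 fun p => by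
    rw [hcol', hcol']
    by_cases hp : (p : ℕ) < 4
    · have h2' : ((E p : Fin (N * 2)) : ℕ) < 4 := by rw [hE_lt p hp]; exact (π ⟨p, hp⟩).2
      rw [if_pos h2', if_pos hp]
    · rw [hE_ge p hp]
  have hu : u = T.rowWord hN ∘ ⇑E := by
    funext p
    apply Fin.ext
    show ((u p : Fin N) : ℕ) = (T.1 (E p)).1
    rw [hrow']
    by_cases hp : (p : ℕ) < 4
    · have h1' := hE_lt p hp
      have h2' : ((E p : Fin (N * 2)) : ℕ) < 4 := by rw [h1']; exact (π ⟨p, hp⟩).2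
      rw [if_pos h2', h1', hπ p hp]
    · rw [hE_ge p hp, if_neg hp]
      by_cases hp' : (p : ℕ) < 12
      · rw [if_pos hp', hdom p (by omega) hp']
      · rw [if_neg hp', harm p (by omega)]
  have h := congrFun (StdFilling.wordPerm_polytabloid_of_mem_colStab (k := ℂ) hN T hEcol) (T.rowWord hN)
  rw [wordPerm_apply, Pi.smul_apply, smul_eq_mul, StdFilling.polytabloid_apply_rowWord, mul_one] at h
  rw [hu, h, hE, Equiv.Perm.sign_extendDomain]

/-- **Domino flip.**  Exchanging the two cells of a domino (a transposition of `C_T`) changes the sign of `e_T`.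
[cite: BurgisserIkenmeyerPanovaJAMS2019, §3(b) (3.5)] -/
theorem oddFiveTableau_apply_comp_swap {N : ℕ} {Y : YoungDiagram} (hN : ∀ x ∈ Y.cells, x.1 < N) (T : StdFilling (N * 2) Y)
    (hT : ∀ p : Fin (N * 2), T.1 p =
      (if (p : ℕ) < 4 then ((p : ℕ), 0) else if (p : ℕ) < 12 then ((p : ℕ) % 2, (p : ℕ) / 2 - 1) else (0, (p : ℕ) - 7)))
    {a b : Fin (N * 2)} (ha : 4 ≤ (a : ℕ)) (hb : (b : ℕ) = (a : ℕ) + 1) (hb12 : (b : ℕ) < 12) (hae : (a : ℕ) % 2 = 0)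
    (u : Word N (N * 2)) : T.polytabloid ℂ hN u = -T.polytabloid ℂ hN (u ∘ ⇑(Equiv.swap a b)) := by
  classical
  have hcol' : ∀ q : Fin (N * 2), (T.1 q).2 =
      if (q : ℕ) < 4 then 0 else if (q : ℕ) < 12 then (q : ℕ) / 2 - 1 else (q : ℕ) - 7 := fun q => by
    rw [hT]; split_ifs <;> rfl
  have hab : a ≠ b := fun h => by have := congrArg Fin.val h; omega
  have hτ : Equiv.swap a b ∈ T.colStab :=
    StdFilling.swap_mem_colStab (by rw [hcol', hcol']; split_ifs <;> omega)
  have h := congrFun (StdFilling.wordPerm_polytabloid_of_mem_colStab (k := ℂ) hN T hτ) u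
  rw [wordPerm_apply, Pi.smul_apply, smul_eq_mul, Equiv.Perm.sign_swap hab] at h
  rw [h]
  simp

/-! ### §2 The value of `e_T` on its support -/

set_option maxHeartbeats 400000 in
/-- **`e_T(u) = sgn π · (-1)^{u(4)+u(6)+u(8)+u(10)}`** on the support, by induction on the number `c` of dominoes read `1`
over `0`. [folklore] -/
theorem oddFiveTableau_apply_eq_sign {N : ℕ} {Y : YoungDiagram} (hN : ∀ x ∈ Y.cells, x.1 < N) (T : StdFilling (N * 2) Y)
    (hT : ∀ p : Fin (N * 2), T.1 p =
      (if (p : ℕ) < 4 then ((p : ℕ), 0) else if (p : ℕ) < 12 then ((p : ℕ) % 2, (p : ℕ) / 2 - 1) else (0, (p : ℕ) - 7)))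
    (h12 : 12 ≤ N * 2) (π : Equiv.Perm (Fin 4)) :
    ∀ (c : ℕ) (u : Word N (N * 2)),
      ((u ⟨4, by omega⟩ : Fin N) : ℕ) + ((u ⟨6, by omega⟩ : Fin N) : ℕ) + ((u ⟨8, by omega⟩ : Fin N) : ℕ) +
          ((u ⟨10, by omega⟩ : Fin N) : ℕ) = c →
      (∀ p : Fin (N * 2), 12 ≤ (p : ℕ) → ((u p : Fin N) : ℕ) = 0) →
      (∀ (p : Fin (N * 2)) (hp : (p : ℕ) < 4), ((π ⟨p, hp⟩ : Fin 4) : ℕ) = ((u p : Fin N) : ℕ)) →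
      (∀ p q : Fin (N * 2), 4 ≤ (p : ℕ) → (q : ℕ) < 12 → (q : ℕ) = (p : ℕ) + 1 → (p : ℕ) % 2 = 0 →
        ((u p : Fin N) : ℕ) + ((u q : Fin N) : ℕ) = 1) →
      T.polytabloid ℂ hN u = ((Equiv.Perm.sign π : ℤ) : ℂ) * (if c % 2 = 0 then 1 else -1) := by
  classical
  intro c
  induction c with
  | zero =>
    intro u hc harm hπ hds
    have htop : ∀ q : Fin (N * 2), ((q : ℕ) = 4 ∨ (q : ℕ) = 6 ∨ (q : ℕ) = 8 ∨ (q : ℕ) = 10) →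
        ((u q : Fin N) : ℕ) = 0 := by
      intro q hq
      rcases hq with hq | hq | hq | hq
      · have e : q = ⟨4, by omega⟩ := Fin.ext hq
        rw [e]; omega
      · have e : q = ⟨6, by omega⟩ := Fin.ext hq
        rw [e]; omega
      · have e : q = ⟨8, by omega⟩ := Fin.ext hq
        rw [e]; omega
      · have e : q = ⟨10, by omega⟩ := Fin.ext hq
        rw [e]; omega
    rw [oddFiveTableau_apply_of_normal hN T hT h12 harm ?_ π hπ]
    · simp
    intro p hp4 hp12
    by_cases hpe : (p : ℕ) % 2 = 0
    · rw [hpe]; exact htop p (by omega)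
    · obtain ⟨q, hq⟩ : ∃ q : Fin (N * 2), (q : ℕ) = (p : ℕ) - 1 := ⟨⟨(p : ℕ) - 1, by omega⟩, rfl⟩
      have h := hds q p (by omega) hp12 (by omega) (by omega)
      have h0 := htop q (by omega)
      omega
  | succ c ih =>
    intro u hc harm hπ hds
    obtain ⟨p4, hp4⟩ : ∃ p : Fin (N * 2), (p : ℕ) = 4 := ⟨⟨4, by omega⟩, rfl⟩
    obtain ⟨p6, hp6⟩ : ∃ p : Fin (N * 2), (p : ℕ) = 6 := ⟨⟨6, by omega⟩, rfl⟩
    obtain ⟨p8, hp8⟩ : ∃ p : Fin (N * 2), (p : ℕ) = 8 := ⟨⟨8, by omega⟩, rfl⟩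
    obtain ⟨p10, hp10⟩ : ∃ p : Fin (N * 2), (p : ℕ) = 10 := ⟨⟨10, by omega⟩, rfl⟩
    have hP4 : (⟨4, by omega⟩ : Fin (N * 2)) = p4 := Fin.ext (by rw [hp4])
    have hP6 : (⟨6, by omega⟩ : Fin (N * 2)) = p6 := Fin.ext (by rw [hp6])
    have hP8 : (⟨8, by omega⟩ : Fin (N * 2)) = p8 := Fin.ext (by rw [hp8])
    have hP10 : (⟨10, by omega⟩ : Fin (N * 2)) = p10 := Fin.ext (by rw [hp10])
    rw [hP4, hP6, hP8, hP10] at hc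
    have hle : ∀ q : Fin (N * 2), ((q : ℕ) = 4 ∨ (q : ℕ) = 6 ∨ (q : ℕ) = 8 ∨ (q : ℕ) = 10) →
        ((u q : Fin N) : ℕ) ≤ 1 := by
      intro q hq
      obtain ⟨r, hr⟩ : ∃ r : Fin (N * 2), (r : ℕ) = (q : ℕ) + 1 := ⟨⟨(q : ℕ) + 1, by omega⟩, rfl⟩
      have h := hds q r (by omega) (by omega) hr (by omega)
      omega
    -- a domino read `1` over `0`
    have hex : ∃ a : Fin (N * 2), ((a : ℕ) = 4 ∨ (a : ℕ) = 6 ∨ (a : ℕ) = 8 ∨ (a : ℕ) = 10) ∧ ((u a : Fin N) : ℕ) = 1 := by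
      by_cases h4 : ((u p4 : Fin N) : ℕ) = 1
      · exact ⟨p4, Or.inl hp4, h4⟩
      by_cases h6 : ((u p6 : Fin N) : ℕ) = 1
      · exact ⟨p6, Or.inr (Or.inl hp6), h6⟩
      by_cases h8 : ((u p8 : Fin N) : ℕ) = 1
      · exact ⟨p8, Or.inr (Or.inr (Or.inl hp8)), h8⟩
      refine ⟨p10, Or.inr (Or.inr (Or.inr hp10)), ?_⟩
      have l4 := hle p4 (Or.inl hp4)
      have l6 := hle p6 (Or.inr (Or.inl hp6))
      have l8 := hle p8 (Or.inr (Or.inr (Or.inl hp8)))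
      have l10 := hle p10 (Or.inr (Or.inr (Or.inr hp10)))
      omega
    obtain ⟨a, ha, hua⟩ := hex
    obtain ⟨b, hb⟩ : ∃ b : Fin (N * 2), (b : ℕ) = (a : ℕ) + 1 := ⟨⟨(a : ℕ) + 1, by omega⟩, rfl⟩
    have hub : ((u b : Fin N) : ℕ) = 0 := by
      have h := hds a b (by omega) (by omega) hb (by omega)
      omega
    -- the flipped word `u ∘ (a b)`
    have hfix : ∀ q : Fin (N * 2), (q : ℕ) ≠ (a : ℕ) → (q : ℕ) ≠ (b : ℕ) → (u ∘ ⇑(Equiv.swap a b)) q = u q :=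
      fun q hqa hqb => by
        show u (Equiv.swap a b q) = u q
        rw [Equiv.swap_apply_of_ne_of_ne (fun h => hqa (congrArg Fin.val h)) (fun h => hqb (congrArg Fin.val h))]
    have hfa : (u ∘ ⇑(Equiv.swap a b)) a = u b := by
      show u (Equiv.swap a b a) = u b
      rw [Equiv.swap_apply_left]
    have hfb : (u ∘ ⇑(Equiv.swap a b)) b = u a := by
      show u (Equiv.swap a b b) = u a
      rw [Equiv.swap_apply_right]
    have ht : ∀ q : Fin (N * 2), ((q : ℕ) = 4 ∨ (q : ℕ) = 6 ∨ (q : ℕ) = 8 ∨ (q : ℕ) = 10) →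
        (((u ∘ ⇑(Equiv.swap a b)) q : Fin N) : ℕ) + (if (q : ℕ) = (a : ℕ) then 1 else 0) = ((u q : Fin N) : ℕ) := by
      intro q hq
      by_cases hqa : (q : ℕ) = (a : ℕ)
      · have e : q = a := Fin.ext hqa
        rw [if_pos hqa, e, hfa, hub, hua]
      · rw [if_neg hqa, hfix q hqa (by omega), add_zero]
    rw [oddFiveTableau_apply_comp_swap hN T hT (a := a) (b := b) (by omega) hb (by omega) (by omega) u,
      ih (u ∘ ⇑(Equiv.swap a b)) ?_ ?_ ?_ ?_]
    · by_cases hce : c % 2 = 0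
      · rw [if_pos hce, if_neg (by omega)]; ring
      · rw [if_neg hce, if_pos (by omega)]; ring
    · rw [hP4, hP6, hP8, hP10]
      have t4 := ht p4 (Or.inl hp4)
      have t6 := ht p6 (Or.inr (Or.inl hp6))
      have t8 := ht p8 (Or.inr (Or.inr (Or.inl hp8)))
      have t10 := ht p10 (Or.inr (Or.inr (Or.inr hp10)))
      split_ifs at t4 t6 t8 t10 <;> omega
    · intro q hq
      rw [hfix q (by omega) (by omega)]
      exact harm q hq
    · intro q hq
      rw [hfix q (by omega) (by omega)]
      exact hπ q hq
    · intro p q hp hq hqp hpe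
      by_cases hpa : (p : ℕ) = (a : ℕ)
      · have ep : p = a := Fin.ext hpa
        have eq : q = b := Fin.ext (by omega)
        rw [ep, eq, hfa, hfb]
        omega
      · rw [hfix p hpa (by omega), hfix q (by omega) (by omega)]
        exact hds p q hp hq hqp hpe

set_option maxHeartbeats 400000 in
/-- **Value of `e_T` on a support word, as a parity.**  `e_T(u) = (-1)^{#inversions of the column reading + u(4)+u(6)+u(8)+u(10)}`.
[folklore] -/
theorem oddFiveTableau_apply_eq_parity {N : ℕ} {Y : YoungDiagram} (hN : ∀ x ∈ Y.cells, x.1 < N)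
    (T : StdFilling (N * 2) Y)
    (hT : ∀ p : Fin (N * 2), T.1 p =
      (if (p : ℕ) < 4 then ((p : ℕ), 0) else if (p : ℕ) < 12 then ((p : ℕ) % 2, (p : ℕ) / 2 - 1) else (0, (p : ℕ) - 7)))
    (h12 : 12 ≤ N * 2) {u : Word N (N * 2)} (harm : ∀ p : Fin (N * 2), 12 ≤ (p : ℕ) → ((u p : Fin N) : ℕ) = 0)
    (hlt : ∀ p : Fin (N * 2), (p : ℕ) < 4 → ((u p : Fin N) : ℕ) < 4)
    (hinj : ∀ p q : Fin (N * 2), (p : ℕ) < 4 → (q : ℕ) < 4 → u p = u q → p = q)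
    (hds : ∀ p q : Fin (N * 2), 4 ≤ (p : ℕ) → (q : ℕ) < 12 → (q : ℕ) = (p : ℕ) + 1 → (p : ℕ) % 2 = 0 →
      ((u p : Fin N) : ℕ) + ((u q : Fin N) : ℕ) = 1) :
    T.polytabloid ℂ hN u =
      if ((if ((u ⟨1, by omega⟩ : Fin N) : ℕ) < ((u ⟨0, by omega⟩ : Fin N) : ℕ) then 1 else 0) +
          (if ((u ⟨2, by omega⟩ : Fin N) : ℕ) < ((u ⟨0, by omega⟩ : Fin N) : ℕ) then 1 else 0) +
          (if ((u ⟨3, by omega⟩ : Fin N) : ℕ) < ((u ⟨0, by omega⟩ : Fin N) : ℕ) then 1 else 0) +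
          (if ((u ⟨2, by omega⟩ : Fin N) : ℕ) < ((u ⟨1, by omega⟩ : Fin N) : ℕ) then 1 else 0) +
          (if ((u ⟨3, by omega⟩ : Fin N) : ℕ) < ((u ⟨1, by omega⟩ : Fin N) : ℕ) then 1 else 0) +
          (if ((u ⟨3, by omega⟩ : Fin N) : ℕ) < ((u ⟨2, by omega⟩ : Fin N) : ℕ) then 1 else 0) +
          (((u ⟨4, by omega⟩ : Fin N) : ℕ) + ((u ⟨6, by omega⟩ : Fin N) : ℕ) + ((u ⟨8, by omega⟩ : Fin N) : ℕ) +
            ((u ⟨10, by omega⟩ : Fin N) : ℕ))) % 2 = 0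
      then 1 else -1 := by
  classical
  let g : Fin 4 → Fin 4 := fun i => ⟨((u ⟨i, by omega⟩ : Fin N) : ℕ), hlt _ (by simp)⟩
  have hg : Function.Injective g := by
    intro i j hij
    have h1 : ((u ⟨i, by omega⟩ : Fin N) : ℕ) = ((u ⟨j, by omega⟩ : Fin N) : ℕ) := by
      have h := Fin.ext_iff.1 hij
      exact h
    have h2 := hinj ⟨i, by omega⟩ ⟨j, by omega⟩ (by simp) (by simp) (Fin.ext h1)
    exact Fin.ext (by simpa using congrArg Fin.val h2)
  let π : Equiv.Perm (Fin 4) := Equiv.ofBijective g (Finite.injective_iff_bijective.1 hg)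
  have hπ : ∀ (p : Fin (N * 2)) (hp : (p : ℕ) < 4), ((π ⟨p, hp⟩ : Fin 4) : ℕ) = ((u p : Fin N) : ℕ) := fun p hp => rfl
  have e0 : ((π 0 : Fin 4) : ℕ) = ((u ⟨0, by omega⟩ : Fin N) : ℕ) := rfl
  have e1 : ((π 1 : Fin 4) : ℕ) = ((u ⟨1, by omega⟩ : Fin N) : ℕ) := rfl
  have e2 : ((π 2 : Fin 4) : ℕ) = ((u ⟨2, by omega⟩ : Fin N) : ℕ) := rfl
  have e3 : ((π 3 : Fin 4) : ℕ) = ((u ⟨3, by omega⟩ : Fin N) : ℕ) := rfl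
  rw [oddFiveTableau_apply_eq_sign hN T hT h12 π _ u rfl harm hπ hds, sign_perm_fin_four_eq π, e0, e1, e2, e3]
  generalize ((if ((u ⟨1, by omega⟩ : Fin N) : ℕ) < ((u ⟨0, by omega⟩ : Fin N) : ℕ) then 1 else 0) +
      (if ((u ⟨2, by omega⟩ : Fin N) : ℕ) < ((u ⟨0, by omega⟩ : Fin N) : ℕ) then 1 else 0) +
      (if ((u ⟨3, by omega⟩ : Fin N) : ℕ) < ((u ⟨0, by omega⟩ : Fin N) : ℕ) then 1 else 0) +
      (if ((u ⟨2, by omega⟩ : Fin N) : ℕ) < ((u ⟨1, by omega⟩ : Fin N) : ℕ) then 1 else 0) +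
      (if ((u ⟨3, by omega⟩ : Fin N) : ℕ) < ((u ⟨1, by omega⟩ : Fin N) : ℕ) then 1 else 0) +
      (if ((u ⟨3, by omega⟩ : Fin N) : ℕ) < ((u ⟨2, by omega⟩ : Fin N) : ℕ) then 1 else 0) : ℕ) = I
  generalize (((u ⟨4, by omega⟩ : Fin N) : ℕ) + ((u ⟨6, by omega⟩ : Fin N) : ℕ) + ((u ⟨8, by omega⟩ : Fin N) : ℕ) +
      ((u ⟨10, by omega⟩ : Fin N) : ℕ) : ℕ) = c
  by_cases hI : I % 2 = 0 <;> by_cases hc : c % 2 = 0 <;> simp only [hI, hc, if_true, if_false] <;> split_ifs <;>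
    first | (exfalso; omega) | norm_num

end Summit.MatrixMultiplication.MatrixMultiplication.Theorems.ObstructionCalculus

end
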